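import Summits.AtomisticToContinuum.Crystallization.Theorems.FrustratedLawDichotomyStrainedPatchHomCurvLJSmoke

/-!
# K-FILE GATE of the centred LJ force-Jacobian leaf at the critic's two-stage cell (`U 2⁻¹¹ × ξ .00125`, corner of record; rows 1097/1102)

decomp-a2c hand-1 g28 (crux `AperiodicFrustratedLawGap`, stmt-AtomisticToContinuum-27623; `(H) HomFloor (1/625)`, hcp half).  Same corner box and label
split as `…HomCurvLJSmoke`; the cell is the critic's: `U`-half-width `2⁻¹¹`, `ξ`-half-width `0.00125`.  ★★ `curvLamLJ_corner_gate`: certified floor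
`> 13/2·SC = 6.5 ≥ 0.906·λ_F` (λ_F = 7.17 float force-Jacobian floor at this corner; `= 0.92 × 7.03` in hand-2's normalisation) — the production gate
`c ≥ 0.85 at 2⁻¹¹` PASSES in the kernel.

One kernel definition (`wGate`) + one kernel fact (`decide +kernel`); 0 sorry; standard axioms.  `--supports stmt-AtomisticToContinuum-27623`.
-/

namespace Summit.AtomisticToContinuum.Crystallization.Theorems.FrustratedLawDichotomyStrainedPatchHomCurvLJ

open Literature.Analysis.ValidatedNumerics.Numerics

/-- Half-widths `2⁻¹¹` (entries) × `0.00125` (shuffle), scaled — the critic's two-stage gate cell. -/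
def wGate : (Fin 3 × Fin 3) ⊕ Fin 3 → ℤ := Sum.elim (fun _ => 137438953472) (fun _ => 351843720888)

/-- ★★ KERNEL GATE (`c ≥ 0.85` at `2⁻¹¹`): certified LJ force-Jacobian floor at the corner of record on `U 2⁻¹¹ × ξ .00125` is `> 6.5 = 0.906·λ_F`
(λ_F = 7.17; `0.92 × 7.03` in hand-2's normalisation). -/
theorem curvLamLJ_corner_gate :
    ((curvLamLJ cCorner wGate (cenLJ cCorner wGate) (naiLJ cCorner wGate)).map fun z => decide (13 * (SC : ℤ) < 2 * z)) = some true := by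
  decide +kernel

end Summit.AtomisticToContinuum.Crystallization.Theorems.FrustratedLawDichotomyStrainedPatchHomCurvLJ
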